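import Summits.RiemannHypothesis.RiemannHypothesis.Theorems.TiltedLandingLaw421R3BurgersRate

/-!
# RATE helper — the UNCOVERED-SIGN IDENTITY (Jensen sign kernel shared by R1uᵀ and the two-pair crossing)

For a state `v` and a foreign zero `z`, both in the upper half plane, the VERTICAL PULL of the pair `{z, z̄}` on `v`'s Newton child is
`pairPull v z := Im(1/(v − z) + 1/(v − z̄)) = (Im z − Im v)/|v − z|² − (Im z + Im v)/|v − z̄|²` (`im_pairField`).
★ `pairPull_nonpos_iff`: `pairPull v z ≤ 0 ↔ Im z² ≤ Im v² + (Re v − Re z)²` — the pair pulls DOWN (or not at all) EXACTLY when `v` is UNCOVERED by `z`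
(the closed Jensen disc of `z` does not contain `v` in its interior), and strictly UP exactly when `z` COVERS `v` (`pairPull_pos_iff`; the covered
anti-drop sign).  Proof: `(b−a)(Δ²+(a+b)²) ≤ (a+b)(Δ²+(b−a)²) ⟺ 2a(a+b)(b−a) ≤ 2aΔ²`.  `sum_pairPull_nonpos`: finitely many uncovering pairs pull down in total.
Newton-step reading: the first-order child of `v` is `v − 1/K` with `K = newtonK` (not the tilt: `K = tiltAt − i/(2·Im v)`); `im_newtonStep_lt_iff`:
`Im(v − 1/K) < Im v ↔ Im K < 0`; `im_inv_sub_conj_self`: the partner `v̄` contributes `−1/(2·Im v)`; `im_neg_of_budget`: `Im K = −1/(2·Im v) + P + F` with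
pair pulls `P ≤ 0` and far vertical part `F < 1/(2·Im v)` gives `Im K < 0`.  Pure algebra over `ℂ` (the two `normSq` expansions are cited from the tree's `…Seam04`, not restated); tree import only; 0 sorry.
What it does NOT give (recorded (CA619)): the EXISTENCE of a child near `v − 1/K` at K-number `≈ 1` (R1uᵀ's leftover), the two-disc located form
(the crossing's leftover), and nothing toward persistence Γ2.  Nothing here bears on the truth of RH; RH is not proved; R1uᵀ / ★A / 33346 / 33347 OPEN.
-/

open Complex
open RhIdea5.G17.W07C9.Helpers (normSq_sub_eq normSq_sub_conj_eq)  -- tree (`…Seam04`): `|p−u|² = Δ²+(Im p−Im u)²`, `|p−ū|² = Δ²+(Im p+Im u)²`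

namespace RhW08.UncoveredSign

/-- The VERTICAL PULL of the pair `{z, z̄}` at the state `v`: `(Im z − Im v)/|v − z|² − (Im z + Im v)/|v − z̄|²`. -/
noncomputable def pairPull (v z : ℂ) : ℝ :=
  (z.im - v.im) / Complex.normSq (v - z) - (z.im + v.im) / Complex.normSq (v - (starRingEnd ℂ) z)

/-- The pull IS the imaginary part of the pair's field at `v`: `Im(1/(v − z) + 1/(v − z̄)) = pairPull v z`. -/
theorem im_pairField (v z : ℂ) : ((v - z)⁻¹ + (v - (starRingEnd ℂ) z)⁻¹).im = pairPull v z := by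
  rw [add_im, inv_im, inv_im, pairPull]
  simp only [sub_im, Complex.conj_im]
  ring

/-- ★ THE UNCOVERED-SIGN IDENTITY: for `v`, `z` in the upper half plane with `v ≠ z`, the pair `{z, z̄}` pulls `v` DOWN or not at all iff `v` is
UNCOVERED by `z` (`Im z² ≤ Im v² + (Re v − Re z)²`). -/
theorem pairPull_nonpos_iff {v z : ℂ} (hv : 0 < v.im) (hz : 0 < z.im) (hvz : v ≠ z) :
    pairPull v z ≤ 0 ↔ z.im ^ 2 ≤ v.im ^ 2 + (v.re - z.re) ^ 2 := by
  have hN1 : 0 < Complex.normSq (v - z) := Complex.normSq_pos.2 (sub_ne_zero.2 hvz)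
  have hN2 : 0 < Complex.normSq (v - (starRingEnd ℂ) z) := by
    rw [normSq_sub_conj_eq]; nlinarith [sq_nonneg (v.re - z.re)]
  rw [pairPull, sub_nonpos, div_le_div_iff₀ hN1 hN2, normSq_sub_conj_eq, normSq_sub_eq]
  constructor
  · intro h; nlinarith [sq_nonneg (v.re - z.re), mul_pos hv hz]
  · intro h; nlinarith [sq_nonneg (v.re - z.re), mul_pos hv hz]

/-- ★ the strict form: the pair pulls `v` strictly DOWN iff `v` is strictly uncovered (`Im z² < Im v² + Δ²`). -/
theorem pairPull_neg_iff {v z : ℂ} (hv : 0 < v.im) (hz : 0 < z.im) (hvz : v ≠ z) :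
    pairPull v z < 0 ↔ z.im ^ 2 < v.im ^ 2 + (v.re - z.re) ^ 2 := by
  have hN1 : 0 < Complex.normSq (v - z) := Complex.normSq_pos.2 (sub_ne_zero.2 hvz)
  have hN2 : 0 < Complex.normSq (v - (starRingEnd ℂ) z) := by
    rw [normSq_sub_conj_eq]; nlinarith [sq_nonneg (v.re - z.re)]
  rw [pairPull, sub_neg, div_lt_div_iff₀ hN1 hN2, normSq_sub_conj_eq, normSq_sub_eq]
  constructor
  · intro h; nlinarith [sq_nonneg (v.re - z.re), mul_pos hv hz]
  · intro h; nlinarith [sq_nonneg (v.re - z.re), mul_pos hv hz]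

/-- ★ the COVERED sign (the anti-drop configurations): the pair pulls `v` strictly UP iff `z` COVERS `v` (`Im v² + Δ² < Im z²`). -/
theorem pairPull_pos_iff {v z : ℂ} (hv : 0 < v.im) (hz : 0 < z.im) (hvz : v ≠ z) :
    0 < pairPull v z ↔ v.im ^ 2 + (v.re - z.re) ^ 2 < z.im ^ 2 := by
  rw [← not_le, pairPull_nonpos_iff hv hz hvz, not_le]

/-- The total pull of finitely many foreign pairs that all leave `v` uncovered is `≤ 0`. -/
theorem sum_pairPull_nonpos {v : ℂ} (hv : 0 < v.im) (Z : Finset ℂ) (hZ : ∀ z ∈ Z, 0 < z.im ∧ v ≠ z ∧ z.im ^ 2 ≤ v.im ^ 2 + (v.re - z.re) ^ 2) :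
    ∑ z ∈ Z, pairPull v z ≤ 0 :=
  Finset.sum_nonpos fun z hz => (pairPull_nonpos_iff hv (hZ z hz).1 (hZ z hz).2.1).2 (hZ z hz).2.2

/-- The partner's own pull: `Im(1/(v − v̄)) = −1/(2·Im v)` (the term that cancels against `+i/(2·Im v)` in the tilt but NOT in `newtonK`). -/
theorem im_inv_sub_conj_self (v : ℂ) : ((v - (starRingEnd ℂ) v)⁻¹).im = -(1 / (2 * v.im)) := by
  have h : v - (starRingEnd ℂ) v = ((2 * v.im : ℝ) : ℂ) * I := by
    apply Complex.ext <;> simp [two_mul]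
  rw [h, mul_inv, ← ofReal_inv, Complex.inv_I, mul_neg, neg_im, mul_comm, I_mul_im, ofReal_re]
  ring

/-- ★ NEWTON-STEP READING: the first-order child `v − 1/K` lies strictly below `v` iff `Im K < 0`. -/
theorem im_newtonStep_lt_iff {v K : ℂ} (hK : K ≠ 0) : (v - K⁻¹).im < v.im ↔ K.im < 0 := by
  have hN : 0 < Complex.normSq K := Complex.normSq_pos.2 hK
  rw [sub_im, inv_im, sub_lt_self_iff, lt_div_iff₀ hN, zero_mul, neg_pos]

/-- ★ the vertical budget: if `K = −i/(2·Im v)·(…)`-wise decomposes as `Im K = −1/(2·Im v) + P + F` with the pair pulls `P ≤ 0` (uncovered) and a far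
vertical part `F < 1/(2·Im v)`, then `Im K < 0` — the Newton child of an everywhere-uncovered lowest state sits below it. -/
theorem im_neg_of_budget {a P F k : ℝ} (hk : k = -(1 / (2 * a)) + P + F) (hP : P ≤ 0) (hF : F < 1 / (2 * a)) : k < 0 := by
  rw [hk]; linarith

/-! ## Sanity instances (the two two-pair data of record) -/

/-- the uncovered datum `v = i`, `z = 2 + 2i` (`4 ≤ 1 + 4`): pull `≤ 0`. -/
example : pairPull I (2 + 2 * I) ≤ 0 :=
  (pairPull_nonpos_iff (v := I) (z := 2 + 2 * I) (by simp) (by simp) (by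
    intro h; have := congrArg Complex.re h; norm_num at this)).2 (by norm_num)

/-- the covered datum `v = i`, `z = 369/10000 + (10065/10000)i` (`1 + 0.0369² < 1.0065²`): pull `> 0` (the mate lifts `v`'s child). -/
example : 0 < pairPull I (369 / 10000 + 10065 / 10000 * I) :=
  (pairPull_pos_iff (v := I) (z := 369 / 10000 + 10065 / 10000 * I) (by simp) (by norm_num) (by
    intro h; have := congrArg Complex.re h; norm_num at this)).2 (by norm_num)

end RhW08.UncoveredSign
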